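import Summits.CriticalPhenomena.PercolationContinuityZ3.Theses.PercBudgetLadder
import Literature.Probability.Percolation.MinOpenCut
import Literature.Probability.Percolation.SharpnessDCTProofs
import Literature.Probability.Percolation.AnchoredProfileAllOpen

/-!
# `DefectDimension` (crux `stmt-CriticalPhenomena-5250`, route `PercBudgetLadder`): negative-side
# support — the parameter is load-bearing, and no deterministic cutset is sub-areal

Support file of the crux disprover (cdisprove seat), all `sorry`-free. The crux reads
`∃ c > 0, P_{p_c(ℤ³)}(E_n(n^{2-c})) → 1` with the budget event

  `E_n(b) = {ω | ∃ S, #S ≤ b ∧ ¬ ∃ x ∈ B(n), ∃ y ∈ ∂B(2n), ω \ S ∈ openConnIn B(2n) x y}`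
  (`= {MinCut(n,2n) ≤ b}`, `Literature.Probability.Percolation.minOpenCutIn_le_iff`).

Proved here:
* `budgetEvent_zero` — the `n = 0` term of the crux's sequence is the EMPTY event (the origin is in
  `B(0) ∩ ∂B(0)`), whatever the budget: harmless for `Tendsto`, fatal for any `∀ n` variant.
* `budgetEvent_anti` — `E_n(b)` is a decreasing event; `empty_mem_budgetEvent` — the empty
  configuration lies in it (`n ≥ 1`, `b ≥ 0`), so the crux's shape holds at `p = 0`
  (`defectDimension_shape_at_zero`): the form is satisfiable, not vacuous.
* `sq_le_card_of_isOpenCutsetIn_allOpen` — **every open cutset of the all-open configuration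
  `E(ℤ³)` separating `B(n)` from `∂B(2n)` inside `B(2n)` has at least `(2n+1)²` edges** (the
  `(2n+1)²` axis-parallel rays are edge-disjoint crossings, each meets the cutset);
  `sq_le_minOpenCutIn_allOpen` (`MinCut(n,2n)(E(ℤ³)) ≥ (2n+1)²`) and
  `sq_le_ncard_of_isEdgeCutsetIn` — a configuration-INDEPENDENT lattice cutset has `≥ (2n+1)²`
  lattice edges, so the first-moment method `MinCut ≤ #(F ∩ ω)` (`minOpenCutIn_le_ncard_inter`)
  with a FIXED `F` has mean `p·#(F ∩ E) ≥ p(2n+1)²` and can never yield a sub-areal budget: a proof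
  of the crux by cutset estimates must use random cutsets (Rossignol–Théret's `Δ W`), whose open
  edges sit under half-space one-arm events — the saving is then a RATE for Barsky–Grimmett–Newman.
* `defectDimension_false_at_one` — **the crux with `p_c` replaced by `p = 1` is FALSE** (for every
  `c > 0`; `P_1 = δ_{E(ℤ³)}` and `(2n+1)² > n² ≥ n^{2-c}`): any proof must use that the parameter
  is `< 1` (indeed critical), not lattice geometry alone.
-/

noncomputable section

namespace Summit.CriticalPhenomena.PercolationContinuityZ3.Theorems.DefectDimension.Negative

open MeasureTheory ProbabilityTheory Filter
open Literature.Probability.Percolation Literature.Probability.LatticeModels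
open scoped Topology

/-! ## §1 The budget event -/

/-- The blocked-with-budget event `E_n(b)` of the route items (`MinCut(n,2n) ≤ b`), budget abstracted. -/
def budgetEvent (n : ℕ) (b : ℝ) : Set (BondConfig (Site 3)) :=
  {ω | ∃ S : Finset (Sym2 (Site 3)), (S.card : ℝ) ≤ b ∧
    ¬ ∃ x ∈ box 3 n, ∃ y ∈ innerBoundary (zdGraph 3) (box 3 (2 * n)),
      (ω \ ↑S) ∈ openConnIn (↑(box 3 (2 * n)) : Set (Site 3)) x y}

/-- The cutset clause of `E_n(b)` is `IsOpenCutsetIn` of `MinOpenCut.lean`. [folklore] -/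
theorem mem_budgetEvent_iff {n : ℕ} {b : ℝ} {ω : BondConfig (Site 3)} :
    ω ∈ budgetEvent n b ↔ ∃ S : Finset (Sym2 (Site 3)), (S.card : ℝ) ≤ b ∧
      IsOpenCutsetIn (↑(box 3 (2 * n)) : Set (Site 3)) ↑(box 3 n)
        ↑(innerBoundary (zdGraph 3) (box 3 (2 * n))) ω ↑S := by
  simp only [budgetEvent, Set.mem_setOf_eq, isOpenCutsetIn_iff_not_exists, Finset.mem_coe]

/-- For natural budgets `E_n(k) = {MinCut(n,2n) ≤ k}`. [folklore] -/
theorem mem_budgetEvent_nat_iff {n k : ℕ} {ω : BondConfig (Site 3)} :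
    ω ∈ budgetEvent n k ↔ minOpenCutIn (↑(box 3 (2 * n)) : Set (Site 3)) ↑(box 3 n)
        ↑(innerBoundary (zdGraph 3) (box 3 (2 * n))) ω ≤ k := by
  rw [minOpenCutIn_le_iff]
  simp only [budgetEvent, Set.mem_setOf_eq, Nat.cast_le, Finset.mem_coe]

/-! ## §2 The index `n = 0` and monotonicity -/

/-- The origin is on the inner boundary of `B(0) = {0}`. [folklore] -/
theorem zero_mem_innerBoundary_box_zero :
    (0 : Site 3) ∈ innerBoundary (zdGraph 3) (box 3 0) :=
  DCT16.mem_innerBoundary_box_of_natAbs_eq (by simp [mem_box]) (i := 0) (by simp)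

/-- **Degenerate index.** `E_0(b) = ∅` for every budget `b`: the `n = 0` term of the crux's
sequence of probabilities is `0`. [folklore] -/
theorem budgetEvent_zero (b : ℝ) : budgetEvent 0 b = ∅ := by
  ext ω
  simp only [Set.mem_empty_iff_false, iff_false]
  rintro ⟨S, -, hS⟩
  apply hS
  refine ⟨0, by simp [mem_box], 0, ?_, ?_⟩
  · simpa using zero_mem_innerBoundary_box_zero
  · have h0 : (0 : Site 3) ∈ (↑(box 3 (2 * 0)) : Set (Site 3)) := by simp [mem_box]
    exact ⟨h0, h0, SimpleGraph.Reachable.refl _⟩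

/-- `E_n(b)` is a DECREASING event: closing edges only helps blocking. [folklore] -/
theorem budgetEvent_anti {n : ℕ} {b : ℝ} {ω ω' : BondConfig (Site 3)} (h : ω ⊆ ω')
    (hω' : ω' ∈ budgetEvent n b) : ω ∈ budgetEvent n b := by
  rw [mem_budgetEvent_iff] at hω' ⊢
  obtain ⟨S, hS, hcut⟩ := hω'
  exact ⟨S, hS, hcut.anti_config h⟩

/-- `E_n(b)` is increasing in the budget. [folklore] -/
theorem budgetEvent_mono_budget {n : ℕ} {b b' : ℝ} (h : b ≤ b') :
    budgetEvent n b ⊆ budgetEvent n b' := by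
  rintro ω ⟨S, hS, hcut⟩
  exact ⟨S, hS.trans h, hcut⟩

/-- For `n ≥ 1`, `B(n)` and `∂B(2n)` are disjoint. [folklore] -/
theorem notMem_box_of_mem_innerBoundary {n : ℕ} (hn : 1 ≤ n) {y : Site 3}
    (hy : y ∈ innerBoundary (zdGraph 3) (box 3 (2 * n))) : y ∉ box 3 n :=
  DCT16.notMem_box_of_mem_innerBoundary_box (by omega) hy

/-- The empty configuration blocks every annulus with budget `0` (`n ≥ 1`). [folklore] -/
theorem empty_mem_budgetEvent {n : ℕ} (hn : 1 ≤ n) {b : ℝ} (hb : 0 ≤ b) :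
    (∅ : BondConfig (Site 3)) ∈ budgetEvent n b := by
  refine ⟨∅, by simpa using hb, ?_⟩
  rintro ⟨x, hx, y, hy, hxS, hyS, hr⟩
  have hr' : (openGraph ((∅ : BondConfig (Site 3)) \ ↑(∅ : Finset (Sym2 (Site 3))))).Reachable
      x y := hr.map (SimpleGraph.Embedding.induce _).toHom
  have hbot : openGraph ((∅ : BondConfig (Site 3)) \ ↑(∅ : Finset (Sym2 (Site 3)))) = ⊥ := by
    rw [Finset.coe_empty, Set.sdiff_empty]
    exact SimpleGraph.fromEdgeSet_empty
  rw [hbot, SimpleGraph.reachable_bot] at hr'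
  subst hr'
  exact notMem_box_of_mem_innerBoundary hn hy hx

/-- **Non-vacuity of the form.** The crux's shape HOLDS at `p = 0` (`P_0 = δ_∅`), with `c = 1`. [folklore] -/
theorem defectDimension_shape_at_zero :
    ∃ c : ℝ, 0 < c ∧ Tendsto (fun n : ℕ =>
      (bondPercolation (zdGraph 3) 0).real (budgetEvent n ((n : ℝ) ^ (2 - c)))) atTop (𝓝 1) := by
  refine ⟨1, one_pos, (tendsto_const_nhds (x := (1 : ℝ))).congr' ?_⟩
  filter_upwards [eventually_ge_atTop 1] with n hn
  rw [bondPercolation, ProbabilityTheory.setBernoulli_zero, measureReal_def,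
    Measure.dirac_apply_of_mem (empty_mem_budgetEvent hn (Real.rpow_nonneg (Nat.cast_nonneg n) _))]
  simp

/-! ## §3 `p = 1`: rays, and the areal lower bound for every cutset -/

/-- Vertex `t` of the ray of `A(n,2n)` through `(n, a, b)` in the direction `e₀`. -/
def rayVert (n : ℕ) (a b : ℤ) (t : ℕ) : Site 3 := ![(n : ℤ) + t, a, b]

/-- Edge `t` of that ray. -/
def rayEdge (n : ℕ) (a b : ℤ) (t : ℕ) : Sym2 (Site 3) := s(rayVert n a b t, rayVert n a b (t + 1))

/-- Coordinate `0` of a ray vertex. [folklore] -/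
@[simp] theorem rayVert_apply_zero (n : ℕ) (a b : ℤ) (t : ℕ) : rayVert n a b t 0 = n + t := rfl
/-- Coordinate `1` of a ray vertex. [folklore] -/
@[simp] theorem rayVert_apply_one (n : ℕ) (a b : ℤ) (t : ℕ) : rayVert n a b t 1 = a := rfl
/-- Coordinate `2` of a ray vertex. [folklore] -/
@[simp] theorem rayVert_apply_two (n : ℕ) (a b : ℤ) (t : ℕ) : rayVert n a b t 2 = b := rfl

/-- Consecutive ray vertices differ by `e₀`. [folklore] -/
theorem rayVert_succ (n : ℕ) (a b : ℤ) (t : ℕ) :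
    rayVert n a b (t + 1) = rayVert n a b t + Pi.single 0 1 := by
  ext i
  fin_cases i
  · simp; ring
  · simp
  · simp

/-- Consecutive ray vertices are adjacent in `ℤ³`. [folklore] -/
theorem rayVert_adj (n : ℕ) (a b : ℤ) (t : ℕ) :
    (zdGraph 3).Adj (rayVert n a b t) (rayVert n a b (t + 1)) :=
  (zdGraph_adj_iff _ _).2 ⟨0, Or.inl (rayVert_succ n a b t)⟩

/-- Ray vertices `t ≤ n` lie in `B(2n)` (`|a|, |b| ≤ n`). [folklore] -/
theorem rayVert_mem_box {n : ℕ} {a b : ℤ} (ha : |a| ≤ n) (hb : |b| ≤ n) {t : ℕ} (ht : t ≤ n) :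
    rayVert n a b t ∈ box 3 (2 * n) := by
  rw [mem_box]
  rw [abs_le] at ha hb
  intro i
  fin_cases i
  · simp; constructor <;> omega
  · simp; constructor <;> omega
  · simp; constructor <;> omega

/-- The ray starts in `B(n)`. [folklore] -/
theorem rayVert_zero_mem_box {n : ℕ} {a b : ℤ} (ha : |a| ≤ n) (hb : |b| ≤ n) :
    rayVert n a b 0 ∈ box 3 n := by
  rw [mem_box]
  rw [abs_le] at ha hb
  intro i
  fin_cases i
  · simp
  · simp; constructor <;> omega
  · simp; constructor <;> omega

/-- The ray ends on `∂B(2n)`. [folklore] -/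
theorem rayVert_last_mem_innerBoundary {n : ℕ} {a b : ℤ} (ha : |a| ≤ n) (hb : |b| ≤ n) :
    rayVert n a b n ∈ innerBoundary (zdGraph 3) (box 3 (2 * n)) :=
  DCT16.mem_innerBoundary_box_of_natAbs_eq (rayVert_mem_box ha hb le_rfl) (i := 0)
    (by simp; omega)

/-- If none of the `n` edges of the ray lies in `T`, the ray is an open crossing of `A(n,2n)` inside
`B(2n)` for the configuration `E(ℤ³) \ T`. [folklore] -/
theorem ray_mem_openConnIn {n : ℕ} {a b : ℤ} (ha : |a| ≤ n) (hb : |b| ≤ n)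
    {T : Set (Sym2 (Site 3))} (hT : ∀ t < n, rayEdge n a b t ∉ T) :
    ((zdGraph 3).edgeSet \ T) ∈
      openConnIn (↑(box 3 (2 * n)) : Set (Site 3)) (rayVert n a b 0) (rayVert n a b n) := by
  have h0 : rayVert n a b 0 ∈ (↑(box 3 (2 * n)) : Set (Site 3)) :=
    Finset.mem_coe.2 (rayVert_mem_box ha hb (Nat.zero_le _))
  have key : ∀ t ≤ n, ∃ ht : rayVert n a b t ∈ (↑(box 3 (2 * n)) : Set (Site 3)),
      ((openGraph ((zdGraph 3).edgeSet \ T)).induce (↑(box 3 (2 * n)) : Set (Site 3))).Reachable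
        ⟨_, h0⟩ ⟨_, ht⟩ := by
    intro t
    induction t with
    | zero => intro _; exact ⟨h0, SimpleGraph.Reachable.refl _⟩
    | succ t ih =>
      intro ht
      obtain ⟨hmem, hr⟩ := ih (by omega)
      have hmem' : rayVert n a b (t + 1) ∈ (↑(box 3 (2 * n)) : Set (Site 3)) :=
        Finset.mem_coe.2 (rayVert_mem_box ha hb ht)
      refine ⟨hmem', hr.trans (SimpleGraph.Adj.reachable ?_)⟩
      refine SimpleGraph.induce_adj.2
        ((openGraph_adj _ _ _).2 ⟨⟨?_, hT t (by omega)⟩, (rayVert_adj n a b t).ne⟩)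
      exact (SimpleGraph.mem_edgeSet _).2 (rayVert_adj n a b t)
  obtain ⟨hn, hr⟩ := key n le_rfl
  exact ⟨h0, hn, hr⟩

/-- Distinct rays have distinct edges. [folklore] -/
theorem rayEdge_inj {n : ℕ} {a b a' b' : ℤ} {t t' : ℕ}
    (h : rayEdge n a b t = rayEdge n a' b' t') : (a, b) = (a', b') := by
  unfold rayEdge at h
  rw [Sym2.eq_iff] at h
  rcases h with ⟨h1, -⟩ | ⟨h1, -⟩
  · have e1 := congrFun h1 1
    have e2 := congrFun h1 2
    simp at e1 e2
    rw [e1, e2]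
  · have e1 := congrFun h1 1
    have e2 := congrFun h1 2
    simp at e1 e2
    rw [e1, e2]

/-- **Every open cutset of the all-open configuration has at least `(2n+1)²` edges**: the
`(2n+1)²` rays `{(n+t, a, b) : 0 ≤ t ≤ n}`, `|a|, |b| ≤ n`, are edge-disjoint open crossings of
`A(n,2n)` inside `B(2n)` when every edge of `ℤ³` is open, and each meets the cutset (weak
duality; Grimmett 1999 §13.1: "the maximum flow cannot exceed the size of any cutset"). [folklore] -/
theorem sq_le_card_of_isOpenCutsetIn_allOpen {n : ℕ} {T : Finset (Sym2 (Site 3))}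
    (hT : IsOpenCutsetIn (↑(box 3 (2 * n)) : Set (Site 3)) ↑(box 3 n)
      ↑(innerBoundary (zdGraph 3) (box 3 (2 * n))) (zdGraph 3).edgeSet ↑T) :
    (2 * n + 1) ^ 2 ≤ T.card := by
  classical
  set I : Finset (ℤ × ℤ) := Finset.Icc (-(n : ℤ)) n ×ˢ Finset.Icc (-(n : ℤ)) n with hI
  have hmeet : ∀ ab ∈ I, ∃ t, t < n ∧ rayEdge n ab.1 ab.2 t ∈ T := by
    rintro ⟨a, b⟩ hab
    simp only [hI, Finset.mem_product, Finset.mem_Icc] at hab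
    have ha : |a| ≤ n := abs_le.2 hab.1
    have hb : |b| ≤ n := abs_le.2 hab.2
    by_contra hcon
    push Not at hcon
    exact hT _ (Finset.mem_coe.2 (rayVert_zero_mem_box ha hb)) _
      (Finset.mem_coe.2 (rayVert_last_mem_innerBoundary ha hb))
      (ray_mem_openConnIn ha hb fun t ht h => hcon t ht (Finset.mem_coe.1 h))
  choose! f hf using hmeet
  have hmaps : Set.MapsTo (fun ab : ℤ × ℤ => rayEdge n ab.1 ab.2 (f ab)) ↑I ↑T := by
    intro ab hab
    exact Finset.mem_coe.2 (hf ab (Finset.mem_coe.1 hab)).2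
  have hinj : Set.InjOn (fun ab : ℤ × ℤ => rayEdge n ab.1 ab.2 (f ab)) ↑I := by
    rintro ⟨a, b⟩ - ⟨a', b'⟩ - h
    exact rayEdge_inj h
  have hcard : I.card = (2 * n + 1) ^ 2 := by
    rw [hI, Finset.card_product, Int.card_Icc]
    have : ((n : ℤ) + 1 - -(n : ℤ)).toNat = 2 * n + 1 := by omega
    rw [this, sq]
  rw [← hcard]
  exact Finset.card_le_card_of_injOn _ hmaps hinj

/-- `MinCut(n,2n) ≥ (2n+1)²` for the all-open configuration: the areal scale `n²` of Zhang's base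
rung is forced deterministically. [folklore] -/
theorem sq_le_minOpenCutIn_allOpen (n : ℕ) :
    (((2 * n + 1) ^ 2 : ℕ) : ℕ∞) ≤ minOpenCutIn (↑(box 3 (2 * n)) : Set (Site 3)) ↑(box 3 n)
      ↑(innerBoundary (zdGraph 3) (box 3 (2 * n))) (zdGraph 3).edgeSet := by
  unfold minOpenCutIn
  exact le_iInf₂ fun T hT => by exact_mod_cast sq_le_card_of_isOpenCutsetIn_allOpen hT

/-- **No configuration-independent cutset beats `n²`.** A lattice cutset `F` of `A(n,2n)` inside
`B(2n)` contains at least `(2n+1)²` lattice edges; so `MinCut ≤ #(F ∩ ω)`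
(`minOpenCutIn_le_ncard_inter`) with a FIXED `F` has `E_p #(F ∩ ω) = p·#(F ∩ E(ℤ³)) ≥ p(2n+1)²`
and cannot give a sub-areal budget at any `p > 0`. [folklore] -/
theorem sq_le_ncard_of_isEdgeCutsetIn {n : ℕ} {F : Set (Sym2 (Site 3))}
    (hF : IsEdgeCutsetIn (zdGraph 3) (↑(box 3 (2 * n)) : Set (Site 3)) ↑(box 3 n)
      ↑(innerBoundary (zdGraph 3) (box 3 (2 * n))) F)
    (hfin : (F ∩ (zdGraph 3).edgeSet).Finite) :
    (2 * n + 1) ^ 2 ≤ (F ∩ (zdGraph 3).edgeSet).ncard := by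
  have h := hF.isOpenCutsetIn_inter (subset_refl (zdGraph 3).edgeSet)
  rw [← hfin.coe_toFinset] at h
  rw [Set.ncard_eq_toFinset_card _ hfin]
  exact sq_le_card_of_isOpenCutsetIn_allOpen h

/-- For `n ≥ 1` and `c ≥ 0` the all-open configuration is NOT in `E_n(n^{2-c})`
(`(2n+1)² > n² ≥ n^{2-c}`). [folklore] -/
theorem edgeSet_notMem_budgetEvent {n : ℕ} (hn : 1 ≤ n) {c : ℝ} (hc : 0 ≤ c) :
    (zdGraph 3).edgeSet ∉ budgetEvent n ((n : ℝ) ^ (2 - c)) := by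
  rw [mem_budgetEvent_iff]
  rintro ⟨S, hS, hcut⟩
  have h1 : (((2 * n + 1) ^ 2 : ℕ) : ℝ) ≤ (S.card : ℝ) := by
    exact_mod_cast sq_le_card_of_isOpenCutsetIn_allOpen hcut
  have h2 : (n : ℝ) ^ (2 - c) ≤ (n : ℝ) ^ 2 := by
    have := Real.rpow_le_rpow_of_exponent_le (x := (n : ℝ)) (by exact_mod_cast hn)
      (show 2 - c ≤ 2 - 0 by linarith)
    rwa [sub_zero, Real.rpow_two] at this
  have hn' : (1 : ℝ) ≤ n := by exact_mod_cast hn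
  push_cast at h1
  nlinarith

/-- `P_1(E_n(n^{2-c})) = 0` for `n ≥ 1`, `c ≥ 0` (`P_1 = δ_{E(ℤ³)}`). [folklore] -/
theorem real_budgetEvent_one {n : ℕ} (hn : 1 ≤ n) {c : ℝ} (hc : 0 ≤ c) :
    (bondPercolation (zdGraph 3) 1).real (budgetEvent n ((n : ℝ) ^ (2 - c))) = 0 := by
  rw [bondPercolation_one_eq_dirac, measureReal_def, Measure.dirac_apply,
    Set.indicator_of_notMem (edgeSet_notMem_budgetEvent hn hc)]
  simp

/-- **`DefectDimension` is false at `p = 1`** (the statement of the crux with `criticalProbI 3`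
replaced by `1`, verbatim otherwise): under `P_1` every cutset of `A(n,2n)` carries
`≥ (2n+1)² > n^{2-c}` open edges, so the probabilities are eventually `0`, not `→ 1`. Any proof of
the crux must use that the parameter is `< 1` (indeed criticality: conjecturally the statement is
false on all of `(p_c, 1]` and true on `[0, p_c)`). [folklore] -/
theorem defectDimension_false_at_one :
    ¬ ∃ c : ℝ, 0 < c ∧ Tendsto (fun n : ℕ => (bondPercolation (zdGraph 3) 1).real
      {ω | ∃ S : Finset (Sym2 (Site 3)), (S.card : ℝ) ≤ (n : ℝ) ^ (2 - c) ∧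
        ¬ ∃ x ∈ box 3 n, ∃ y ∈ innerBoundary (zdGraph 3) (box 3 (2 * n)),
          (ω \ ↑S) ∈ openConnIn (↑(box 3 (2 * n)) : Set (Site 3)) x y}) atTop (𝓝 1) := by
  rintro ⟨c, hc, h⟩
  have h0 : Tendsto (fun n : ℕ => (bondPercolation (zdGraph 3) 1).real
      (budgetEvent n ((n : ℝ) ^ (2 - c)))) atTop (𝓝 0) := by
    refine (tendsto_const_nhds (x := (0 : ℝ))).congr' ?_
    filter_upwards [eventually_ge_atTop 1] with n hn
    exact (real_budgetEvent_one hn hc.le).symm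
  exact zero_ne_one (tendsto_nhds_unique h0 h)

end Summit.CriticalPhenomena.PercolationContinuityZ3.Theorems.DefectDimension.Negative

end
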